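import Summits.AnomalousDissipation.AnomalousDissipation.Theorems.SawtoothPulseCascadeK1LocalisedCascadeFibreMarginals

/-!
# K1loc, line `Spectral` / thin start — helper: A SHEAR ACTS ON EACH SLAB OF THE SPECTRUM AS A CHIRP (exact fibre reduction)

Helper file of the prover lane on the crux `K1LocalisedCascade` (stmt-AnomalousDissipation-19491), route
`SawtoothPulseCascade` (S-B/S-C assembly seat; Fourier bookkeeping for the S-D channel functionals).  Continuation of
`…FibreMarginals`: for the shear `Φ(x) = x − φ(x_j)eᵢ` (`Torus.shearMap i j φ`) the twisted axis average along the sheared axis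
obeys `A^i_m(v ∘ Φ) = g_m(x_j)·A^i_m v` with the unimodular CHIRP `g_m = twist φ m = e_{−m} ∘ φ`.  Since the spectrum of `A^i_m u`
is exactly the slab `{kᵢ = m}` of the spectrum of `u` (`…StripBlock.mFourierCoeff_twistedAxisAvg`), this gives the exact,
mode-by-mode **fibre reduction of the Koopman operator**: `𝓕(v ∘ Φ)(k) = 𝓕(g_{kᵢ}(x_j)·A^i_{kᵢ} v)(k)` for EVERY `k`
(`mFourierCoeff_comp_shearMap_eq_chirp`) — on the slab `kᵢ = m` the shear is multiplication of the fibre component `A^i_m v`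
(a function of the form `β_m(x̂ᵢ)·e_m(xᵢ)`) by the chirp `g_m(x_j)`, i.e. a ONE-DIMENSIONAL problem in the variable `x_j` for each
`m` («exact 1-D Egorov»).  Consequently every weighted spectral functional of `v ∘ Φ` is the fibre sum of the same functional of
the chirped fibre components: **`Σ' k, W(k)‖𝓕(v ∘ Φ)(k)‖² = Σ' m, Σ' k, [kᵢ = m]·W(k)·‖𝓕(g_m(x_j)·A^i_m v)(k)‖²`** for bounded `W`
(`tsum_weight_comp_shearMap_eq_fibre_chirp`; fibrewise summation `hasSum_fibre_of_bounded`), with `Σ' m, ∫‖A^i_m v‖² = ∫‖v‖²`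
(`hasSum_integral_twistedAxisAvg_sq`).  For the cascade's V half-step (`i = 1`, `j = 0`) and a HORIZONTAL weight `W(k) = w(k₀)` this
is the starting identity of both crux ideas on the S-D target (`renormalised-escape-weight` (b): the kick of the saturated
horizontal functional happens fibre by fibre through the chirp `e^{∓2πi m γ U_n(x₀)}`; `averaged-comb-ledger` (ii): on each linear
piece of `U_n` the chirp is an exact frequency translation) — `tsum_horizontalWeight_vstep_eq_fibre_chirp`.
No definitions; no statement about the crux. [cite: Grafakos2014, Prop. 3.1.2 (5) and Prop. 3.2.7 (3)] [problem: turb]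
-/

-- `Summit.<Summit>.<Problem>`: single-conjunct summit, the duplicate namespace segment is deliberate.
set_option linter.dupNamespace false

noncomputable section

namespace Summit.AnomalousDissipation.AnomalousDissipation.Theorems.SawtoothPulseCascade.K1Start

open MeasureTheory Set Filter Topology UnitAddTorus Function
open Literature.Analysis.FunctionSpaces Literature.Analysis.FunctionSpaces.Torus

variable {d : Type*} [Fintype d] [DecidableEq d]

/-! ## §1 Mode by mode: the shear is a chirp on each slab -/

/-- **Fibre reduction of the shear Koopman operator, mode by mode**: for continuous `v`, `i ≠ j`, a profile `φ` and EVERY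
frequency `k`, `𝓕(v ∘ Φ)(k) = 𝓕(x ↦ g_{kᵢ}(x_j)·A^i_{kᵢ}v(x))(k)`, where `A^i_m v(x) = ∫ e_{−m}(s)v(x + s eᵢ)ds` is the fibre
component and `g_m = twist φ m = e_{−m} ∘ φ` the chirp. [cite: Grafakos2014, Prop. 3.1.2 (5)] -/
theorem mFourierCoeff_comp_shearMap_eq_chirp {v : UnitAddTorus d → ℂ} (hv : Continuous v) {i j : d} (hij : i ≠ j)
    (P : ShearProfile) (k : d → ℤ) :
    mFourierCoeff (v ∘ shearMap i j P) k =
      mFourierCoeff (fun x => twist P (k i) (x j) * ∫ s : UnitAddCircle, (fourier (-(k i)) s : ℂ) • v (x + Pi.single i s)) k := by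
  have hvΦ : Continuous (v ∘ shearMap i j P) := hv.comp (continuous_shearMap i j P)
  -- the slab `kᵢ = kᵢ` of `v ∘ Φ` is its own fibre component …
  have h1 := mFourierCoeff_twistedAxisAvg hvΦ i (k i) k
  rw [if_pos rfl] at h1
  rw [← h1]
  -- … and the fibre component of `v ∘ Φ` is the chirped fibre component of `v`
  congr 1
  funext x
  exact twistedAxisAvg_comp_shearMap v hij P (k i) x

/-- **Slab by slab**: on the slab `kᵢ = m`, `‖𝓕(v ∘ Φ)(k)‖² = ‖𝓕(g_m(x_j)·A^i_m v)(k)‖²`; written with the slab indicator so that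
both sides vanish off the slab. [cite: Grafakos2014, Prop. 3.1.2 (5)] -/
theorem slab_indicator_mul_sq_norm_comp_shearMap {v : UnitAddTorus d → ℂ} (hv : Continuous v) {i j : d} (hij : i ≠ j)
    (P : ShearProfile) (m : ℤ) (k : d → ℤ) :
    (if k i = m then (1 : ℝ) else 0) * ‖mFourierCoeff (v ∘ shearMap i j P) k‖ ^ 2 =
      (if k i = m then (1 : ℝ) else 0) *
        ‖mFourierCoeff (fun x => twist P m (x j) * ∫ s : UnitAddCircle, (fourier (-m) s : ℂ) • v (x + Pi.single i s)) k‖ ^ 2 := by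
  by_cases hk : k i = m
  · rw [if_pos hk, mFourierCoeff_comp_shearMap_eq_chirp hv hij P k, hk]
  · rw [if_neg hk, zero_mul, zero_mul]

/-! ## §2 Fibrewise summation with a general bounded weight -/

omit [Fintype d] [DecidableEq d] in
/-- **Fibrewise summation**: for `c ≥ 0` summable on `ℤ^d` and a bounded weight `W` (`|W| ≤ C`),
`HasSum (m ↦ Σ' k, [kᵢ = m]·W(k)·c(k)) (Σ' k, W(k)·c(k))`. [cite: Grafakos2014, Prop. 3.2.7 (3)] -/
theorem hasSum_fibre_of_bounded (i : d) {c : (d → ℤ) → ℝ} (hc : Summable c) (hc0 : ∀ k, 0 ≤ c k) {W : (d → ℤ) → ℝ}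
    {C : ℝ} (hW : ∀ k, |W k| ≤ C) :
    HasSum (fun m : ℤ => ∑' k : d → ℤ, (if k i = m then (1 : ℝ) else 0) * (W k * c k)) (∑' k : d → ℤ, W k * c k) := by
  classical
  have hsW : Summable fun k : d → ℤ => W k * c k := by
    refine Summable.of_norm_bounded (g := fun k => C * c k) (hc.mul_left C) fun k => ?_
    rw [Real.norm_eq_abs, abs_mul, abs_of_nonneg (hc0 k)]
    exact mul_le_mul_of_nonneg_right (hW _) (hc0 k)
  set e := Equiv.sigmaFiberEquiv (fun k : d → ℤ => k i) with he
  have h1 : HasSum ((fun k : d → ℤ => W k * c k) ∘ e) (∑' k : d → ℤ, W k * c k) := e.hasSum_iff.2 hsW.hasSum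
  refine h1.sigma fun m => ?_
  -- the inner sum over the fibre `{k : kᵢ = m}` is the indicator series
  have h2 : HasSum (fun k : {k : d → ℤ // k i = m} => W (k : d → ℤ) * c (k : d → ℤ))
      (∑' k : d → ℤ, (if k i = m then (1 : ℝ) else 0) * (W k * c k)) := by
    have h3 : (fun k : d → ℤ => (if k i = m then (1 : ℝ) else 0) * (W k * c k)) =
        Set.indicator {k | k i = m} (fun k => W k * c k) := by
      funext k
      simp only [Set.indicator, Set.mem_setOf_eq]
      split_ifs <;> simp
    rw [h3]
    have h4 : HasSum (Set.indicator {k | k i = m} (fun k => W k * c k))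
        (∑' k : d → ℤ, Set.indicator {k | k i = m} (fun k => W k * c k) k) := (hsW.indicator _).hasSum
    rw [← hasSum_subtype_iff_indicator] at h4
    exact h4
  refine h2.congr_fun fun k => ?_
  obtain ⟨k, hk⟩ := k
  simp only [Function.comp_apply, he, Equiv.sigmaFiberEquiv_apply]

/-- **Parseval across the fibres**: `Σ' m, ∫‖A^i_m v‖² = ∫‖v‖²` for continuous `v`. [cite: Grafakos2014, Prop. 3.2.7 (3)] -/
theorem hasSum_integral_twistedAxisAvg_sq {v : UnitAddTorus d → ℂ} (hv : Continuous v) (i : d) :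
    HasSum (fun m : ℤ => ∫ x : UnitAddTorus d, ‖∫ s : UnitAddCircle, (fourier (-m) s : ℂ) • v (x + Pi.single i s)‖ ^ 2)
      (∫ x : UnitAddTorus d, ‖v x‖ ^ 2) := by
  have hP := hasSum_sq_mFourierCoeff_of_continuous hv
  have h := hasSum_fibreWeight i hP.summable (fun _ => sq_nonneg _) (fun m => hasSum_slab hv i m) (w := fun _ => (1 : ℝ))
    (C := 1) (fun _ => by norm_num)
  simp only [one_mul] at h
  rwa [hP.tsum_eq] at h

/-! ## §3 Weighted spectral functionals of `v ∘ Φ` as fibre sums of chirped fibre components -/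

/-- **Exact fibre reduction of a weighted spectral functional under a shear**: for continuous `v`, `i ≠ j`, a profile `φ` and a
bounded weight `W` on `ℤ^d`,
`Σ' k, W(k)‖𝓕(v ∘ Φ)(k)‖² = Σ' m, Σ' k, [kᵢ = m]·W(k)·‖𝓕(x ↦ g_m(x_j)·A^i_m v(x))(k)‖²` —
on each slab the shear is the multiplication of the fibre component by the chirp `g_m(x_j) = e_{−m}(φ(x_j))`.
[cite: Grafakos2014, Prop. 3.1.2 (5) and Prop. 3.2.7 (3)] -/
theorem tsum_weight_comp_shearMap_eq_fibre_chirp {v : UnitAddTorus d → ℂ} (hv : Continuous v) {i j : d} (hij : i ≠ j)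
    (P : ShearProfile) {W : (d → ℤ) → ℝ} {C : ℝ} (hW : ∀ k, |W k| ≤ C) :
    ∑' k : d → ℤ, W k * ‖mFourierCoeff (v ∘ shearMap i j P) k‖ ^ 2 =
      ∑' m : ℤ, ∑' k : d → ℤ, (if k i = m then (1 : ℝ) else 0) * (W k *
        ‖mFourierCoeff (fun x => twist P m (x j) * ∫ s : UnitAddCircle, (fourier (-m) s : ℂ) • v (x + Pi.single i s)) k‖ ^ 2) := by
  have hvΦ : Continuous (v ∘ shearMap i j P) := hv.comp (continuous_shearMap i j P)
  have h := hasSum_fibre_of_bounded i (hasSum_sq_mFourierCoeff_of_continuous hvΦ).summable (fun _ => sq_nonneg _) hW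
  rw [← h.tsum_eq]
  refine tsum_congr fun m => tsum_congr fun k => ?_
  rw [← mul_assoc, ← mul_assoc, mul_right_comm _ (W k), mul_right_comm _ (W k),
    slab_indicator_mul_sq_norm_comp_shearMap hv hij P m k]

/-- **The cascade's V half-step, exact horizontal bookkeeping**: for `a' = b ∘ shearMap 1 0 ψ` (continuous `b`, any profile
`ψ`) and a bounded weight `w` of the HORIZONTAL frequency,
`Σ' k, w(k₀)‖𝓕a'(k)‖² = Σ' m, Σ' k, [k₁ = m]·w(k₀)·‖𝓕(x ↦ g_m(x₀)·A¹_m b(x))(k)‖²`, `g_m = e_{−m} ∘ ψ`: the low band / strip /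
saturated horizontal functional after the V half-step is the sum over the vertical fibres `m` of the same functional of the fibre
component `A¹_m b` multiplied by the chirp `e_{−m}(ψ(x₀))` — one 1-D problem in `x₀` per fibre.
[cite: Grafakos2014, Prop. 3.1.2 (5) and Prop. 3.2.7 (3)] -/
theorem tsum_horizontalWeight_vstep_eq_fibre_chirp {b a' : UnitAddTorus (Fin 2) → ℝ} (hb : Continuous b) (ψ : ShearProfile)
    (ha' : a' = b ∘ shearMap 1 0 ψ) {w : ℤ → ℝ} {C : ℝ} (hw : ∀ m, |w m| ≤ C) :
    ∑' k : Fin 2 → ℤ, w (k 0) * ‖mFourierCoeff (fun x => (a' x : ℂ)) k‖ ^ 2 =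
      ∑' m : ℤ, ∑' k : Fin 2 → ℤ, (if k 1 = m then (1 : ℝ) else 0) * (w (k 0) *
        ‖mFourierCoeff (fun x => twist ψ m (x 0) *
          ∫ s : UnitAddCircle, (fourier (-m) s : ℂ) • ((b (x + Pi.single (1 : Fin 2) s) : ℝ) : ℂ)) k‖ ^ 2) := by
  have hbc : Continuous (fun x => (b x : ℂ)) := Complex.continuous_ofReal.comp hb
  have h := tsum_weight_comp_shearMap_eq_fibre_chirp hbc (show (1 : Fin 2) ≠ 0 by decide) ψ (W := fun k => w (k 0))
    (fun k => hw (k 0))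
  rw [ha']
  exact h

/-- **The cascade's H half-step, exact vertical bookkeeping** (the twin): for `b = a ∘ shearMap 0 1 ψ` and a bounded weight `w`
of the VERTICAL frequency, `Σ' k, w(k₁)‖𝓕b(k)‖² = Σ' m, Σ' k, [k₀ = m]·w(k₁)·‖𝓕(x ↦ g_m(x₁)·A⁰_m a(x))(k)‖²`.
[cite: Grafakos2014, Prop. 3.1.2 (5) and Prop. 3.2.7 (3)] -/
theorem tsum_verticalWeight_hstep_eq_fibre_chirp {a b : UnitAddTorus (Fin 2) → ℝ} (ha : Continuous a) (ψ : ShearProfile)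
    (hb : b = a ∘ shearMap 0 1 ψ) {w : ℤ → ℝ} {C : ℝ} (hw : ∀ m, |w m| ≤ C) :
    ∑' k : Fin 2 → ℤ, w (k 1) * ‖mFourierCoeff (fun x => (b x : ℂ)) k‖ ^ 2 =
      ∑' m : ℤ, ∑' k : Fin 2 → ℤ, (if k 0 = m then (1 : ℝ) else 0) * (w (k 1) *
        ‖mFourierCoeff (fun x => twist ψ m (x 1) *
          ∫ s : UnitAddCircle, (fourier (-m) s : ℂ) • ((a (x + Pi.single (0 : Fin 2) s) : ℝ) : ℂ)) k‖ ^ 2) := by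
  have hac : Continuous (fun x => (a x : ℂ)) := Complex.continuous_ofReal.comp ha
  have h := tsum_weight_comp_shearMap_eq_fibre_chirp hac (show (0 : Fin 2) ≠ 1 by decide) ψ (W := fun k => w (k 1))
    (fun k => hw (k 1))
  rw [hb]
  exact h

end Summit.AnomalousDissipation.AnomalousDissipation.Theorems.SawtoothPulseCascade.K1Start
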